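import Summits.AnomalousDissipation.AnomalousDissipation.Theorems.LaminarNeverLoud.Negative.PowerBudget

/-!
# Negative knowledge for the crux `LaminarNeverLoud` (stmt-AnomalousDissipation-2988): IV, enstrophy balance, stretching floor, planar theorem

Certified copy of §4 of the cdisprove work file `Cruxes/LaminarNeverLoud/Disproof.lean`.  Supports
stmt-AnomalousDissipation-2988.  The ENSTROPHY BALANCE at a steady Galerkin state in every dimension
(`enstrophy_balance_at_zero`: `16π⁴ν∑|k|⁴‖c‖² = ∫⟪ΔU,(U·∇)U⟫ + 4π²∑|k|²Re⟪ĝ,c⟫`, master identity III of the tree),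
the interpolation `(∑|k|²‖c‖²)² ≤ energy·∑|k|⁴‖c‖²`, the injection bound and Bessel for `Δf` uniformly in `N`;
whence the WITNESS ANATOMY `sq_le_stretching_of_loud` (loud bounded steady states have stretching production
`≥ ε²/(νE) − ‖Δf‖₂√E`) and the PLANAR THEOREM `steadyNeverLoud_planar` / `lnl_planar`: on `T²` the analogue of the
crux holds for EVERY component, uniformly in `N` (`dissipation² ≤ ν‖Δf‖₂E^{3/2}`, the steady Galerkin
Alexakis–Doering bound).  The 3-D content of the crux is the stretching term on the laminar component.
-/

noncomputable section

namespace Summit.AnomalousDissipation.AnomalousDissipation.Theorems.LaminarNeverLoud.Negative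

open MeasureTheory Set Filter Topology UnitAddTorus
open scoped InnerProductSpace
open Literature.Analysis.FluidPDE Literature.Analysis.FluidPDE.Torus
open Literature.Analysis.FunctionSpaces Literature.Analysis.FunctionSpaces.Torus
-- (fullbuild repair 2026-08-16: the former `open …Theses.MirrorVariety (LaminarNeverLoud)` is gone — the crux was
-- DROPPED from the route at rev 14; its verbatim statement now lives in this namespace as the
-- `@[conjecture] def Negative.LaminarNeverLoud` of `PowerBudget.lean`; no declaration of this file names it.)

variable {d : Type*} [Fintype d] [DecidableEq d]

/-! ## §4 The enstrophy balance at a steady state; the PLANAR analogue is TRUE without laminarity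

Master identity III of the tree (`sum_freqNormSq_mul_re_inner_galerkinField_self`, FMRT 2001 App. II.A
(A.55) at the Galerkin level) at a zero of the Galerkin field reads
`ν‖ΔU‖² = ∫⟪ΔU,(U·∇)U⟫ + 4π² ∑|k|² Re⟪ĝ k, c k⟫` (enstrophy dissipation = vortex-stretching production +
enstrophy injection).  On `T²` the production vanishes identically (FMRT (A.62), tree
`integral_inner_laplacian_convect_self_eq_zero`), the injection is `≤ ‖Δf‖₂‖U‖₂/(4π²)·4π²`, and
Cauchy–Schwarz `‖∇U‖⁴ ≤ ‖U‖²‖ΔU‖²` gives `(ν‖∇U‖²)² ≤ ν ‖Δf‖₂ E^{3/2}` at EVERY steady Galerkin state of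
EVERY resolution: the planar crux holds with `ν₀ = ε²/(‖Δf‖₂E^{3/2}+1)`, for all components.  So the
content of `LaminarNeverLoud` is exactly the stretching term in `d = 3`. -/

section Enstrophy

/-- **Enstrophy balance at a steady Galerkin state** (every dimension):
`16π⁴ν ∑|k|⁴‖c k‖² = ∫⟪ΔU,(U·∇)U⟫ + 4π² ∑|k|² Re⟪g k, c k⟫`, `U = realTrigPoly S c̄`.
[cite: FoiasManleyRosaTemam2001, App. II.A (A.55)] -/
theorem enstrophy_balance_at_zero {S : Finset (d → ℤ)} (hS : ∀ k ∈ S, -k ∈ S) {ν : ℝ}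
    {g c : ↥S → EuclideanSpace ℂ d} (hg : IsRealCoeff g) (hc : c ∈ galerkinSubspace S)
    (h0 : galerkinRHS S ν g c = 0) :
    ν * (16 * Real.pi ^ 4 * ∑ k : ↥S, freqNormSq (k : d → ℤ) ^ 2 * ‖c k‖ ^ 2) =
      (∫ x, ⟪Literature.Analysis.FunctionSpaces.Torus.laplacian (realTrigPoly S (coeffExt S c)) x,
          Literature.Analysis.FunctionSpaces.Torus.convect (realTrigPoly S (coeffExt S c))
            (realTrigPoly S (coeffExt S c)) x⟫_ℝ) +
        4 * Real.pi ^ 2 * ∑ k : ↥S, freqNormSq (k : d → ℤ) * (inner ℂ (g k) (c k)).re := by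
  have hIII := sum_freqNormSq_mul_re_inner_galerkinField_self ν hS (hg.isConjSymm_coeffExt hS)
    (hc.1.isConjSymm_coeffExt hS) hc.2.isTransversal_coeffExt
  have hL : ∑ k ∈ S, freqNormSq k * (inner ℂ (coeffExt S c k)
      (galerkinField ν S (coeffExt S g) (coeffExt S c) k)).re = 0 := by
    refine Finset.sum_eq_zero fun k hk => ?_
    have h := congrFun h0 ⟨k, hk⟩
    rw [galerkinRHS_apply, Pi.zero_apply] at h
    rw [h, inner_zero_right, Complex.zero_re, mul_zero]
  rw [hL, mul_zero, toReal_eLaplacianNormSq_coeffExt hS hc.1,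
    integral_inner_realTrigPoly_laplacian_eq_sum hS hg hc.1] at hIII
  have hF : ∑ k : ↥S, (inner ℂ (g k)
      (-(((4 * Real.pi ^ 2 * freqNormSq (k : d → ℤ) : ℝ) : ℂ) • c k))).re =
      -(4 * Real.pi ^ 2 * ∑ k : ↥S, freqNormSq (k : d → ℤ) * (inner ℂ (g k) (c k)).re) := by
    rw [Finset.mul_sum, ← Finset.sum_neg_distrib]
    refine Finset.sum_congr rfl fun k _ => ?_
    rw [inner_neg_right, Complex.neg_re, inner_smul_right, Complex.re_ofReal_mul]
    ring
  rw [hF] at hIII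
  linarith

omit [DecidableEq d] in
/-- Cauchy–Schwarz between energy, enstrophy and palinstrophy sums: `(∑|k|²‖c‖²)² ≤ (∑‖c‖²)(∑|k|⁴‖c‖²)`,
i.e. `‖∇U‖⁴ ≤ ‖U‖²‖ΔU‖²`. [folklore] -/
theorem enstrophySum_sq_le {S : Finset (d → ℤ)} (c : ↥S → EuclideanSpace ℂ d) :
    (∑ k : ↥S, freqNormSq (k : d → ℤ) * ‖c k‖ ^ 2) ^ 2 ≤
      energy c * ∑ k : ↥S, freqNormSq (k : d → ℤ) ^ 2 * ‖c k‖ ^ 2 := by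
  have h := Finset.sum_mul_sq_le_sq_mul_sq Finset.univ (fun k : ↥S => ‖c k‖)
    (fun k => freqNormSq (k : d → ℤ) * ‖c k‖)
  calc (∑ k : ↥S, freqNormSq (k : d → ℤ) * ‖c k‖ ^ 2) ^ 2
      = (∑ k : ↥S, ‖c k‖ * (freqNormSq (k : d → ℤ) * ‖c k‖)) ^ 2 := by
        congr 1; exact Finset.sum_congr rfl fun k _ => by ring
    _ ≤ (∑ k : ↥S, ‖c k‖ ^ 2) * ∑ k : ↥S, (freqNormSq (k : d → ℤ) * ‖c k‖) ^ 2 := h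
    _ = energy c * ∑ k : ↥S, freqNormSq (k : d → ℤ) ^ 2 * ‖c k‖ ^ 2 := by
        unfold energy
        congr 1; exact Finset.sum_congr rfl fun k _ => by ring

omit [DecidableEq d] in
/-- The enstrophy injection is controlled by `‖Δf‖₂‖U‖₂`: `∑|k|² Re⟪g k, c k⟫ ≤ √(∑|k|⁴‖g‖²) √(energy c)`. [folklore] -/
theorem enstrophyInjection_le {S : Finset (d → ℤ)} (g c : ↥S → EuclideanSpace ℂ d) :
    ∑ k : ↥S, freqNormSq (k : d → ℤ) * (inner ℂ (g k) (c k)).re ≤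
      Real.sqrt (∑ k : ↥S, freqNormSq (k : d → ℤ) ^ 2 * ‖g k‖ ^ 2) * Real.sqrt (energy c) := by
  have h1 : ∑ k : ↥S, freqNormSq (k : d → ℤ) * (inner ℂ (g k) (c k)).re ≤
      ∑ k : ↥S, (freqNormSq (k : d → ℤ) * ‖g k‖) * ‖c k‖ := by
    refine Finset.sum_le_sum fun k _ => ?_
    rw [mul_assoc]
    exact mul_le_mul_of_nonneg_left ((Complex.re_le_norm _).trans (norm_inner_le_norm _ _))
      (freqNormSq_nonneg _)
  refine h1.trans ?_
  rw [← Real.sqrt_mul (Finset.sum_nonneg fun k _ => mul_nonneg (sq_nonneg _) (sq_nonneg _))]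
  refine Real.le_sqrt_of_sq_le ?_
  calc (∑ k : ↥S, (freqNormSq (k : d → ℤ) * ‖g k‖) * ‖c k‖) ^ 2
      ≤ (∑ k : ↥S, (freqNormSq (k : d → ℤ) * ‖g k‖) ^ 2) * ∑ k : ↥S, ‖c k‖ ^ 2 :=
        Finset.sum_mul_sq_le_sq_mul_sq _ _ _
    _ = (∑ k : ↥S, freqNormSq (k : d → ℤ) ^ 2 * ‖g k‖ ^ 2) * energy c := by
        unfold energy
        congr 1; exact Finset.sum_congr rfl fun k _ => by ring

/-- Bessel for `Δf`: `16π⁴ ∑_{k∈S} |k|⁴ ‖f̂ k‖² ≤ ∫‖Δf‖²` — the enstrophy-injection weight of the force vector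
is bounded UNIFORMLY IN THE RESOLUTION by the smooth force. [folklore] -/
theorem laplacianWeight_forceCoeff_le (S : Finset (d → ℤ)) {f : UnitAddTorus d → EuclideanSpace ℝ d}
    (hf : IsSmooth f) :
    16 * Real.pi ^ 4 * ∑ k : ↥S, freqNormSq (k : d → ℤ) ^ 2 * ‖forceCoeff S f k‖ ^ 2 ≤
      ∫ x, ‖Literature.Analysis.FunctionSpaces.Torus.laplacian f x‖ ^ 2 := by
  have h := energy_forceCoeff_le S (hf.laplacian.memLp 2)
  have heq : energy (forceCoeff S (Literature.Analysis.FunctionSpaces.Torus.laplacian f)) =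
      16 * Real.pi ^ 4 * ∑ k : ↥S, freqNormSq (k : d → ℤ) ^ 2 * ‖forceCoeff S f k‖ ^ 2 := by
    unfold energy forceCoeff
    rw [Finset.mul_sum]
    refine Finset.sum_congr rfl fun k _ => ?_
    rw [mFourierCoeff_complexify_laplacian hf, norm_neg, norm_smul, Complex.norm_real,
      Real.norm_of_nonneg (mul_nonneg (by positivity) (freqNormSq_nonneg _)), mul_pow]
    ring
  rw [heq] at h
  exact h

/-- **WITNESS ANATOMY (every dimension, every component): LOUD BOUNDED STEADY STATES MUST STRETCH.**
At a steady Galerkin state with `energy ≤ E` and `dissipation ≥ ε ≥ 0` (`ν > 0`),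
`ε² ≤ ν E (∫⟪ΔU,(U·∇)U⟫ + 4π² √(∑|k|⁴‖g‖²) √E)`, i.e. the vortex-stretching production of enstrophy is
`≥ ε²/(νE) − ‖Δf‖₂√E → +∞` as `ν → 0`.  A refutation of the crux must exhibit laminar-connected states
whose enstrophy production diverges like `ν⁻¹`; a proof may assume it. [folklore] -/
theorem sq_le_stretching_of_loud {S : Finset (d → ℤ)} (hS : ∀ k ∈ S, -k ∈ S) {ν : ℝ} (hν : 0 < ν)
    {g c : ↥S → EuclideanSpace ℂ d} (hg : IsRealCoeff g) (hc : c ∈ galerkinSubspace S)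
    (h0 : galerkinRHS S ν g c = 0) {E ε : ℝ} (hE : energy c ≤ E) (hε : 0 ≤ ε)
    (hloud : ε ≤ dissipation ν c) :
    ε ^ 2 ≤ ν * E *
      ((∫ x, ⟪Literature.Analysis.FunctionSpaces.Torus.laplacian (realTrigPoly S (coeffExt S c)) x,
          Literature.Analysis.FunctionSpaces.Torus.convect (realTrigPoly S (coeffExt S c))
            (realTrigPoly S (coeffExt S c)) x⟫_ℝ) +
        4 * Real.pi ^ 2 * (Real.sqrt (∑ k : ↥S, freqNormSq (k : d → ℤ) ^ 2 * ‖g k‖ ^ 2) * Real.sqrt E)) := by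
  have hbal := enstrophy_balance_at_zero hS hg hc h0
  have hW := enstrophySum_sq_le c
  have hinj := enstrophyInjection_le g c
  have hEn := energy_nonneg c
  have hE0 : 0 ≤ E := hEn.trans hE
  have hP0 : 0 ≤ ∑ k : ↥S, freqNormSq (k : d → ℤ) ^ 2 * ‖c k‖ ^ 2 :=
    Finset.sum_nonneg fun k _ => mul_nonneg (sq_nonneg _) (sq_nonneg _)
  have hG0 : 0 ≤ Real.sqrt (∑ k : ↥S, freqNormSq (k : d → ℤ) ^ 2 * ‖g k‖ ^ 2) := Real.sqrt_nonneg _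
  -- ε² ≤ D² = 16π⁴ν²W² ≤ 16π⁴ν² En P ≤ ν E (16π⁴ ν P) = ν E (stretch + 4π² inj) ≤ ν E (stretch + 4π² G₂ √E)
  have h1 : ε ^ 2 ≤ dissipation ν c ^ 2 := pow_le_pow_left₀ hε hloud 2
  have h2 : dissipation ν c ^ 2 ≤ ν * E * (ν * (16 * Real.pi ^ 4 *
      ∑ k : ↥S, freqNormSq (k : d → ℤ) ^ 2 * ‖c k‖ ^ 2)) := by
    calc dissipation ν c ^ 2
        = 16 * Real.pi ^ 4 * ν ^ 2 * (∑ k : ↥S, freqNormSq (k : d → ℤ) * ‖c k‖ ^ 2) ^ 2 := by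
          unfold dissipation; ring
      _ ≤ 16 * Real.pi ^ 4 * ν ^ 2 * (energy c * ∑ k : ↥S, freqNormSq (k : d → ℤ) ^ 2 * ‖c k‖ ^ 2) :=
          mul_le_mul_of_nonneg_left hW (by positivity)
      _ ≤ 16 * Real.pi ^ 4 * ν ^ 2 * (E * ∑ k : ↥S, freqNormSq (k : d → ℤ) ^ 2 * ‖c k‖ ^ 2) :=
          mul_le_mul_of_nonneg_left (mul_le_mul_of_nonneg_right hE hP0) (by positivity)
      _ = ν * E * (ν * (16 * Real.pi ^ 4 * ∑ k : ↥S, freqNormSq (k : d → ℤ) ^ 2 * ‖c k‖ ^ 2)) := by ring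
  rw [hbal] at h2
  have h3 : 4 * Real.pi ^ 2 * ∑ k : ↥S, freqNormSq (k : d → ℤ) * (inner ℂ (g k) (c k)).re ≤
      4 * Real.pi ^ 2 * (Real.sqrt (∑ k : ↥S, freqNormSq (k : d → ℤ) ^ 2 * ‖g k‖ ^ 2) * Real.sqrt E) :=
    mul_le_mul_of_nonneg_left (hinj.trans (mul_le_mul_of_nonneg_left (Real.sqrt_le_sqrt hE) hG0))
      (by positivity)
  have h4 := mul_le_mul_of_nonneg_left ((add_le_add_iff_left
    (∫ x, ⟪Literature.Analysis.FunctionSpaces.Torus.laplacian (realTrigPoly S (coeffExt S c)) x,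
          Literature.Analysis.FunctionSpaces.Torus.convect (realTrigPoly S (coeffExt S c))
            (realTrigPoly S (coeffExt S c)) x⟫_ℝ)).2 h3) (mul_nonneg hν.le hE0)
  exact h1.trans (h2.trans h4)

end Enstrophy

section Planar

/-- On `T²` the stretching term drops: `16π⁴ν∑|k|⁴‖c‖² ≤ 4π² √(∑|k|⁴‖g‖²) √(energy c)` at every steady state. [folklore] -/
theorem planar_palinstrophy_le {S : Finset (Fin 2 → ℤ)} (hS : ∀ k ∈ S, -k ∈ S) {ν : ℝ}
    {g c : ↥S → EuclideanSpace ℂ (Fin 2)} (hg : IsRealCoeff g) (hc : c ∈ galerkinSubspace S)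
    (h0 : galerkinRHS S ν g c = 0) :
    ν * (16 * Real.pi ^ 4 * ∑ k : ↥S, freqNormSq (k : Fin 2 → ℤ) ^ 2 * ‖c k‖ ^ 2) ≤
      4 * Real.pi ^ 2 * (Real.sqrt (∑ k : ↥S, freqNormSq (k : Fin 2 → ℤ) ^ 2 * ‖g k‖ ^ 2) *
        Real.sqrt (energy c)) := by
  have h := enstrophy_balance_at_zero hS hg hc h0
  rw [integral_inner_laplacian_convect_self_eq_zero (isSmooth_realTrigPoly S _)
    (isDivFree_realTrigPoly hc.2.isTransversal_coeffExt), zero_add] at h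
  rw [h]
  exact mul_le_mul_of_nonneg_left (enstrophyInjection_le g c) (by positivity)

/-- **The planar dissipation bound**: on `T²`, at every steady Galerkin state with `ν ≥ 0`,
`dissipation² ≤ 4π²ν √(∑|k|⁴‖g‖²) · energy^{3/2}` — the steady, Galerkin form of the Alexakis–Doering bound
`ε ≲ ν^{1/2}` (cf. `Literature.Barriers.AnomalousDissipation.AlexakisDoering2006_energyDissipationBound`).
[cite: AlexakisDoering2006PLA] -/
theorem dissipation_sq_le_planar {S : Finset (Fin 2 → ℤ)} (hS : ∀ k ∈ S, -k ∈ S) {ν : ℝ} (hν : 0 ≤ ν)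
    {g c : ↥S → EuclideanSpace ℂ (Fin 2)} (hg : IsRealCoeff g) (hc : c ∈ galerkinSubspace S)
    (h0 : galerkinRHS S ν g c = 0) :
    dissipation ν c ^ 2 ≤ 4 * Real.pi ^ 2 * ν *
      Real.sqrt (∑ k : ↥S, freqNormSq (k : Fin 2 → ℤ) ^ 2 * ‖g k‖ ^ 2) *
        (energy c * Real.sqrt (energy c)) := by
  have hW := enstrophySum_sq_le c
  have hP := planar_palinstrophy_le hS hg hc h0
  have hEn := energy_nonneg c
  calc dissipation ν c ^ 2
      = 16 * Real.pi ^ 4 * ν ^ 2 * (∑ k : ↥S, freqNormSq (k : Fin 2 → ℤ) * ‖c k‖ ^ 2) ^ 2 := by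
        unfold dissipation; ring
    _ ≤ 16 * Real.pi ^ 4 * ν ^ 2 *
        (energy c * ∑ k : ↥S, freqNormSq (k : Fin 2 → ℤ) ^ 2 * ‖c k‖ ^ 2) :=
        mul_le_mul_of_nonneg_left hW (by positivity)
    _ = ν * energy c * (ν * (16 * Real.pi ^ 4 * ∑ k : ↥S, freqNormSq (k : Fin 2 → ℤ) ^ 2 * ‖c k‖ ^ 2)) := by
        ring
    _ ≤ ν * energy c * (4 * Real.pi ^ 2 *
        (Real.sqrt (∑ k : ↥S, freqNormSq (k : Fin 2 → ℤ) ^ 2 * ‖g k‖ ^ 2) * Real.sqrt (energy c))) :=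
        mul_le_mul_of_nonneg_left hP (mul_nonneg hν hEn)
    _ = _ := by ring

/-- **THE PLANAR ANALOGUE OF THE CRUX IS TRUE — FOR EVERY COMPONENT, UNIFORMLY IN `N`.**  On `T²`, for every
smooth force `f` (solenoidality and zero mean not needed) and budgets `E`, `ε > 0`, with
`ν₀ = ε²/(‖Δf‖₂ E^{3/2} + 1)`: every steady Galerkin state of every resolution with `0 < ν < ν₀` and
`energy ≤ E` has `dissipation < ε`.  (The barrier note "LaminarNeverLoud is automatically true in 2-D",
certified at the Galerkin level; the 3-D content of the crux is the stretching term of §4.) [folklore] -/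
theorem steadyNeverLoud_planar (f : UnitAddTorus (Fin 2) → EuclideanSpace ℝ (Fin 2)) (hf : IsSmooth f)
    (E ε : ℝ) (hε : 0 < ε) : ∃ ν₀ : ℝ, 0 < ν₀ ∧ ∀ N : ℕ,
      ∀ z ∈ steadySet (modes (Fin 2) N) (forceCoeff (modes (Fin 2) N) f),
        0 < z.2 → z.2 < ν₀ → energy z.1 ≤ E → dissipation z.2 z.1 < ε := by
  set L : ℝ := ∫ x, ‖Literature.Analysis.FunctionSpaces.Torus.laplacian f x‖ ^ 2 with hL
  set K : ℝ := Real.sqrt L * (max E 0 * Real.sqrt (max E 0)) with hK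
  have hK0 : 0 ≤ K := by positivity
  refine ⟨ε ^ 2 / (K + 1), by positivity, fun N z hz hpos hlt hzE => ?_⟩
  have hS := modes_symm (d := Fin 2) N
  have hg : IsRealCoeff (forceCoeff (modes (Fin 2) N) f) :=
    isRealCoeff_forceCoeff _ ((hf.memLp 2).integrable one_le_two)
  have hEn := energy_nonneg z.1
  have hE0 : 0 ≤ E := hEn.trans hzE
  have hmax : max E 0 = E := max_eq_left hE0
  have hD := dissipation_sq_le_planar hS hpos.le hg hz.1 hz.2
  set G : ℝ := Real.sqrt (∑ k : ↥(modes (Fin 2) N),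
    freqNormSq (k : Fin 2 → ℤ) ^ 2 * ‖forceCoeff (modes (Fin 2) N) f k‖ ^ 2) with hG
  have hG0 : 0 ≤ G := Real.sqrt_nonneg _
  have hG4 : 4 * Real.pi ^ 2 * G ≤ Real.sqrt L := by
    refine Real.le_sqrt_of_sq_le ?_
    rw [mul_pow, hG, Real.sq_sqrt (Finset.sum_nonneg fun k _ => mul_nonneg (sq_nonneg _) (sq_nonneg _))]
    calc (4 * Real.pi ^ 2) ^ 2 * ∑ k : ↥(modes (Fin 2) N),
          freqNormSq (k : Fin 2 → ℤ) ^ 2 * ‖forceCoeff (modes (Fin 2) N) f k‖ ^ 2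
        = 16 * Real.pi ^ 4 * ∑ k : ↥(modes (Fin 2) N),
          freqNormSq (k : Fin 2 → ℤ) ^ 2 * ‖forceCoeff (modes (Fin 2) N) f k‖ ^ 2 := by ring
      _ ≤ L := laplacianWeight_forceCoeff_le _ hf
  have hEE : energy z.1 * Real.sqrt (energy z.1) ≤ E * Real.sqrt E :=
    mul_le_mul hzE (Real.sqrt_le_sqrt hzE) (Real.sqrt_nonneg _) hE0
  have h1 : dissipation z.2 z.1 ^ 2 ≤ z.2 * K := by
    calc dissipation z.2 z.1 ^ 2 ≤ 4 * Real.pi ^ 2 * z.2 * G * (energy z.1 * Real.sqrt (energy z.1)) := hD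
      _ = z.2 * ((4 * Real.pi ^ 2 * G) * (energy z.1 * Real.sqrt (energy z.1))) := by ring
      _ ≤ z.2 * (Real.sqrt L * (E * Real.sqrt E)) :=
          mul_le_mul_of_nonneg_left (mul_le_mul hG4 hEE (by positivity) (Real.sqrt_nonneg _)) hpos.le
      _ = z.2 * K := by rw [hK, hmax]
  have h2 : z.2 * K ≤ z.2 * (K + 1) := by nlinarith
  have h3 : z.2 * (K + 1) < ε ^ 2 / (K + 1) * (K + 1) := mul_lt_mul_of_pos_right hlt (by linarith)
  rw [div_mul_cancel₀ _ (by linarith : K + 1 ≠ 0)] at h3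
  have h4 : dissipation z.2 z.1 ^ 2 < ε ^ 2 := by linarith
  exact lt_of_pow_lt_pow_left₀ 2 hε.le h4

/-- **The literal planar transcription of the crux HOLDS** (laminarity, solenoidality and zero mean unused).
[folklore] -/
theorem lnl_planar :
    ∀ f : UnitAddTorus (Fin 2) → EuclideanSpace ℝ (Fin 2), IsSmooth f → IsDivFree f → HasZeroMean f →
      ∀ E ε : ℝ, 0 < ε → ∃ ν₀ : ℝ, 0 < ν₀ ∧ ∀ N : ℕ,
        ∀ z ∈ steadySet (modes (Fin 2) N) (forceCoeff (modes (Fin 2) N) f),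
          z ∈ laminarSet (steadySet (modes (Fin 2) N) (forceCoeff (modes (Fin 2) N) f)) →
            0 < z.2 → z.2 < ν₀ → energy z.1 ≤ E → dissipation z.2 z.1 < ε := by
  intro f hf _ _ E ε hε
  obtain ⟨ν₀, hν₀, H⟩ := steadyNeverLoud_planar f hf E ε hε
  exact ⟨ν₀, hν₀, fun N z hz _ hpos hlt hE => H N z hz hpos hlt hE⟩

end Planar

end Summit.AnomalousDissipation.AnomalousDissipation.Theorems.LaminarNeverLoud.Negative
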